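import Literature.AlgebraicGeometry.HodgeTheory.MotivatedClassesDeformationInputs
import HarnessLib

/-!
# André's deformation theorem (1996, Thm. 0.5): the four published leaves of the §5.1 proof

Family `hodge`, layer `Literature/AlgebraicGeometry/HodgeTheory`. Decomposition file (librarian,
fact-decompose, 2026-08-16) for the named fact `Andre1996_deformation` (`MotivatedClasses.lean`;
Y. André, *Pour une théorie inconditionnelle des motifs*, Publ. Math. IHÉS 83 (1996), Thm. 0.5,
proof §5.1 p. 25), which two prove seats triaged XL.

The tree already proves the whole ARCHITECTURE of §5.1 on the real carriers
(`MotivatedClassesDeformation.lean`, `MotivatedClassesDeformationInputs.lean`,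
`MotivatedClassesTransport.lean`): `Andre1996_deformation_of_published_inputs` derives the fact from
five hypotheses, each the verbatim statement of a published theorem — (A0) the curve lemma on affine
varieties, (A1) Hironaka's smooth compactification, (A2) Deligne's théorème de la partie fixe (the
tree's named fact `deligne_globalInvariantCycles`), (A3) André's Thm. 0.4 in its §5.1 form, (A5)
André's Prop. 2.1 (ii) — the flat-section input (A4) being discharged there
(`Andre1996_deformation_hflat`). Under D-0026 the prove seats could not name these inputs; this
file names the four that are not yet facts of the tree, each in exactly the shape the accepted
assembly consumes, and records the assembly as the checked implication
`Andre1996_deformation_holds_of`. Nothing here restates the parent: each child is a statement about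
a different object (curves on affine varieties; compactifications; one fixed morphism `j : X ⟶ X̄`
of smooth projective varieties), and the parent is about families.

## Children (named facts introduced here)

* `Mumford_curveLemma_affine` — (A0) Mumford, *Abelian Varieties*, §6, Lemma (p. 56), with the
  normalisation of the curve;
* `Hironaka1964_smoothCompactification` — (A1) Hironaka 1964, Main Theorem I (smooth completion of
  a smooth quasi-projective variety);
* `Andre1996_exists_motivated_of_motivated_pullback` — (A3) André 1996, §5.1 second paragraph via
  Thm. 0.4 (semisimplicity of motivated motives);
* `Andre1996_motivatedClasses_pullback` — (A5) André 1996, Prop. 2.1 (ii) and p. 15.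

(A2) is the existing named fact `deligne_globalInvariantCycles` (`GlobalInvariantCycles.lean`).

## Main result

* `Andre1996_deformation_holds_of : Mumford_curveLemma_affine → Hironaka1964_smoothCompactification →
  deligne_globalInvariantCycles → Andre1996_exists_motivated_of_motivated_pullback →
  Andre1996_motivatedClasses_pullback → Andre1996_deformation` — PROVED
  (`Andre1996_deformation_of_published_inputs`).

## Mathlib / tree search

`lean search` (2026-08-16): no named fact for a curve lemma / `exists_curve_through`, none for a
smooth compactification (`Hironaka1964`, `Hironaka1964_projective`, `Hironaka1964_local` in
`Literature/AlgebraicGeometry/Resolution` are resolution statements for singular schemes, not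
completions of smooth ones), none for Prop. 2.1 / Thm. 0.4 on the real carriers `motivatedClasses`
(the `B`-parametrised `Motives.Andre1996_thm04_*` of `MotivatedAutPoints.lean` live on abstract
`BettiHodgeData`, not on `complexBetti`).

## References

* [Andre1996Motifs] Y. André, Pour une théorie inconditionnelle des motifs, Publ. Math. IHÉS 83
  (1996): Thm. 0.4 (p. 7), Thm. 0.5 (p. 8), Prop. 2.1 (p. 15), §5.1 (p. 25).
* [MumfordAV1970] D. Mumford, Abelian Varieties, Oxford University Press 1970, §6, Lemma (p. 56).
* [Hironaka1964] H. Hironaka, Resolution of singularities of an algebraic variety over a field of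
  characteristic zero, Ann. of Math. 79 (1964), Main Theorem I.
* [DeligneHodgeII1971] P. Deligne, Théorie de Hodge II, Publ. Math. IHÉS 40 (1971), Thm. 4.1.1.
-/

noncomputable section

open CategoryTheory CategoryTheory.Limits AlgebraicGeometry MonoidalCategory CartesianMonoidalCategory
open Literature.AlgebraicTopology.SingularHomology

namespace Literature.AlgebraicGeometry.HodgeTheory

/-- NAMED FACT — **the curve lemma on an affine variety** (Mumford, *Abelian Varieties*, §6, Lemma,
p. 56: "Any two points of an irreducible variety `X` are contained in an irreducible curve `C` on
`X`"; André 1996, §5.1 p. 25: "Il existe une variété affine lisse connexe `S'` (par exemple une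
courbe) et un morphisme `S' → S` tel que l'image de `S'(ℂ)` dans `S(ℂ)` contienne `s` et `t`"), in
the shape consumed by `Andre1996_deformation_of_affine_curves`: for an affine `ℂ`-scheme `S` locally
of finite type, a closed irreducible subset `Z ⊆ S` and two complex points `s, t` of `S` lying in
`Z`, there are a SMOOTH, quasi-projective, irreducible `ℂ`-scheme `S'`, a morphism `g : S' ⟶ S` and
complex points `s', t'` of `S'` with `g(s') = s`, `g(t') = t` (the normalisation of Mumford's curve
through `s` and `t` in the affine variety `Z_red`; the normalisation of an integral curve over `ℂ`
is smooth and quasi-projective, and surjects onto the curve). Users take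
`(h : Mumford_curveLemma_affine)`. [cite: MumfordAV1970, §6 Lemma (p. 56)]
[cite: Andre1996Motifs, §5.1 (p. 25)] -/
def Mumford_curveLemma_affine : Prop :=
  ∀ (S : Motives.SchemeOver ℂ), IsAffine S.left → LocallyOfFiniteType S.hom →
    ∀ (Z : Set S.left), IsClosed Z → IsIrreducible Z →
    ∀ (s t : Motives.ComplexPoints S), s.pt ∈ Z → t.pt ∈ Z →
      ∃ (S' : Motives.SchemeOver ℂ) (g : S' ⟶ S) (s' t' : Motives.ComplexPoints S'),
        AlgebraicGeometry.Smooth S'.hom ∧ IsQuasiProjectiveOver S' ∧ IrreducibleSpace S'.left ∧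
          Motives.AlgPoints.map g s' = s ∧ Motives.AlgPoints.map g t' = t

/-- NAMED FACT — **Hironaka's smooth compactification** (Hironaka 1964, Main Theorem I, in the
form quoted by André 1996, §5.1 p. 25: "`X` est un schéma quasi projectif lisse, et il existe,
d'après H. Hironaka, une compactification lisse `X̄` de `X`"): a smooth complex `ℂ`-scheme of
relative dimension `m` which is quasi-projective and irreducible is an open subscheme of a smooth
projective complex variety of dimension `m` (take the closure in projective space and resolve its
singularities, which lie off `X`, by Main Theorem I). Users take
`(h : Hironaka1964_smoothCompactification)`. [cite: Hironaka1964, Main Theorem I]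
[cite: Andre1996Motifs, §5.1 (p. 25)] -/
def Hironaka1964_smoothCompactification : Prop :=
  ∀ (m : ℕ) (X : Motives.SchemeOver ℂ), SmoothOfRelativeDimension m X.hom →
    IsQuasiProjectiveOver X → IrreducibleSpace X.left →
    ∃ (Xbar : Motives.SchemeOver ℂ) (i : X ⟶ Xbar),
      Motives.IsSmoothProjective m Xbar ∧ IsOpenImmersion i.left

/-- NAMED FACT — **André 1996, the motivic step of §5.1 (via Thm. 0.4)** ("Puisque la catégorie des
motifs est abélienne (0.4) […] en fait, `ξ_s` provient d'un cycle motivé sur `X̄`", §5.1 p. 25), on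
the real carriers: for a morphism `j : X ⟶ X̄` of smooth projective complex varieties (of dimensions
`n` and `m`) and a class `Ā ∈ H²ᵖ(X̄(ℂ); ℂ)` whose pull-back `j^* Ā` is motivated on `X`, there is a
MOTIVATED class `Ā'` of `X̄` with the same pull-back `j^* Ā' = j^* Ā`. (In print: `j^*` is a morphism
of motivated motives `h(X̄)(p) → h(X)(p)`; by the semisimplicity of Thm. 0.4 its image is a direct
summand and `j^*` splits over it, while a motivated class of `X` lying in the Betti realisation of
the image factors through the image since `H_B` is faithful; `ℂ`-spans by
`(V ⊗ ℂ) ∩ (W ⊗ ℂ) = (V ∩ W) ⊗ ℂ`.) Users take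
`(h : Andre1996_exists_motivated_of_motivated_pullback)`.
[cite: Andre1996Motifs, §5.1 (p. 25) with Thm. 0.4 (p. 7)] -/
def Andre1996_exists_motivated_of_motivated_pullback : Prop :=
  ∀ ⦃m n : ℕ⦄ ⦃Xbar X : Motives.SchemeOver ℂ⦄ (j : X ⟶ Xbar),
    Motives.IsSmoothProjective m Xbar → Motives.IsSmoothProjective n X →
    ∀ (p : ℕ) (Ā : complexBetti Xbar (2 * p)),
      complexBetti.map j (2 * p) Ā ∈ motivatedClasses n X p →
      ∃ Ā' ∈ motivatedClasses m Xbar p, complexBetti.map j (2 * p) Ā' = complexBetti.map j (2 * p) Ā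

/-- NAMED FACT — **André 1996, Prop. 2.1 (ii) with p. 15: motivated classes are stable under
pull-backs** ("le formalisme `f^*`, `f_*` (pour un morphisme `f`) en composant les correspondances
motivées avec la classe du graphe de `f` ou sa transposée"), on the real carriers: for a morphism
`j : X ⟶ X̄` of smooth projective complex varieties (of dimensions `n` and `m`) and every `p`,
`j^*` maps `A_motᵖ(X̄)_ℂ` into `A_motᵖ(X)_ℂ`. Users take `(h : Andre1996_motivatedClasses_pullback)`.
[cite: Andre1996Motifs, Prop. 2.1 (ii) and p. 15] -/
def Andre1996_motivatedClasses_pullback : Prop :=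
  ∀ ⦃m n : ℕ⦄ ⦃Xbar X : Motives.SchemeOver ℂ⦄ (j : X ⟶ Xbar),
    Motives.IsSmoothProjective m Xbar → Motives.IsSmoothProjective n X →
    ∀ (p : ℕ), ∀ Ā' ∈ motivatedClasses m Xbar p,
      complexBetti.map j (2 * p) Ā' ∈ motivatedClasses n X p

/-- **André's deformation theorem `Andre1996_deformation` (Thm. 0.5) from the four leaves above and
Deligne's théorème de la partie fixe** — the accepted §5.1 assembly
`Andre1996_deformation_of_published_inputs` with its five hypotheses named.
[cite: Andre1996Motifs, Thm. 0.5 (p. 8) and §5.1 (p. 25)] [cite: DeligneHodgeII1971, Théorème 4.1.1] -/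
theorem Andre1996_deformation_holds_of (hcurve : Mumford_curveLemma_affine)
    (hHir : Hironaka1964_smoothCompactification) (hD : deligne_globalInvariantCycles)
    (h04 : Andre1996_exists_motivated_of_motivated_pullback)
    (h21 : Andre1996_motivatedClasses_pullback) : Andre1996_deformation :=
  Andre1996_deformation_of_published_inputs hcurve hHir hD h04 h21

end Literature.AlgebraicGeometry.HodgeTheory

end
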